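import Literature.Topology.FourManifolds.TautFoliations
import HarnessLib

/-!
# Closed transversals of transversely oriented `C⁰` foliations have a constant direction

Sibling of `TautFoliations.lean`, which defines topological closed transversals
(`Foliation.IsClosedTransversal γ`: a continuous `1`-periodic `γ : ℝ → M` that near each
parameter runs inside one flow box with strictly monotone — increasing *or* decreasing —
transverse coordinate) and transverse orientations (`Foliation.IsTransverselyOriented`: the
changes of coordinates of the atlas are locally increasing in the transverse coordinate) of a
`C⁰` codimension-one foliation `F : Literature.Topology.FourManifolds.Foliation B M`. This file proves the remark of
the design notes of that file: **for a transversely oriented foliation the direction of a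
closed transversal is the same at all parameters**, so that closed transversals (in particular
the witnesses of tautness, `Foliation.IsTaut`) may be taken *positively* transverse
(Hector–Hirsch, *Introduction to the Geometry of Foliations, Part A*, Ch. II 2.2.8–2.2.9:
for a transversely oriented foliation a transverse curve is positively or negatively
transverse; Ch. I 2.3.7: topological transversality).

* `Foliation.IsPosTransverseAt F γ s`, `Foliation.IsNegTransverseAt F γ s` (**definitions**):
  `γ` is positively (negatively) transverse to `F` at the parameter `s` — near `s` it runs in
  one flow box of the atlas with strictly increasing (decreasing) height. A closed transversal
  is, at each parameter, one or the other (`IsClosedTransversal.isPosTransverseAt_or`).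
* `isOpen_setOf_isPosTransverseAt`, `isOpen_setOf_isNegTransverseAt` (**proved**): both
  conditions are open in `s`.
* `IsPosTransverseAt.exists_strictMonoOn` (**proved**): **the direction does not depend on
  the flow box** — for a transversely oriented atlas, a curve positively transverse at `s` has
  strictly increasing height near `s` in *every* flow box of the atlas containing `γ s`
  (similarly `IsNegTransverseAt.exists_strictAntiOn`); hence it is not both positively and
  negatively transverse at `s` (`not_isPosTransverseAt_and_isNegTransverseAt`).
* `IsClosedTransversal.forall_isPosTransverseAt_or` (**proved**): **constant direction** — a
  closed transversal of a transversely oriented foliation is positively transverse at every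
  parameter or negatively transverse at every parameter (`ℝ` is connected).
* `IsClosedTransversal.reverse` (**proved**): `s ↦ γ (-s)` is a closed transversal with the
  opposite direction; consequently **a taut transversely oriented foliation has a positive
  closed transversal through every leaf** (`IsTaut.exists_pos`).

## References

* G. Hector, U. Hirsch, *Introduction to the Geometry of Foliations, Part A*, 2nd ed., Vieweg
  (1986), Ch. I 2.3.7; Ch. II 2.2.8, 2.2.9 [HectorHirsch1986].

## Design notes

* As in `TautFoliations.lean`, transversality is topological (strict monotonicity of the height
  along the curve inside one flow box); no smoothness or embeddedness is used or concluded.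
-/

open scoped Topology
open Function Set Filter

namespace Literature.Topology.FourManifolds

namespace Foliation

variable {B : Type*} [TopologicalSpace B] {M : Type*} [TopologicalSpace M]
variable (F : Foliation B M)

/-! ## Positive and negative transversality at a parameter -/

/-- `γ` is **positively transverse** to `F` at the parameter `s`: some flow box `e` of the atlas
contains `γ (s - ε, s + ε)` for some `ε > 0`, and the transverse coordinate `r ↦ (e (γ r)).2`
is strictly increasing there (Hector–Hirsch A, Ch. II 2.2.9 (iii), Ch. I 2.3.7). [folklore] -/
def IsPosTransverseAt (γ : ℝ → M) (s : ℝ) : Prop :=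
  ∃ e ∈ F.atlas, ∃ ε > (0 : ℝ), MapsTo γ (Ioo (s - ε) (s + ε)) e.source ∧
    StrictMonoOn (fun r ↦ (e (γ r)).2) (Ioo (s - ε) (s + ε))

/-- `γ` is **negatively transverse** to `F` at the parameter `s`: as `IsPosTransverseAt`, with
strictly decreasing transverse coordinate. [folklore] -/
def IsNegTransverseAt (γ : ℝ → M) (s : ℝ) : Prop :=
  ∃ e ∈ F.atlas, ∃ ε > (0 : ℝ), MapsTo γ (Ioo (s - ε) (s + ε)) e.source ∧
    StrictAntiOn (fun r ↦ (e (γ r)).2) (Ioo (s - ε) (s + ε))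

variable {F} {γ : ℝ → M} {s : ℝ}

/-- A closed transversal is, at each parameter, positively or negatively transverse (this is
its definition). [folklore] -/
theorem IsClosedTransversal.isPosTransverseAt_or (hγ : F.IsClosedTransversal γ) (s : ℝ) :
    F.IsPosTransverseAt γ s ∨ F.IsNegTransverseAt γ s := by
  obtain ⟨e, he, ε, hε, hmaps, hmono | hanti⟩ := hγ.2.2 s
  · exact Or.inl ⟨e, he, ε, hε, hmaps, hmono⟩
  · exact Or.inr ⟨e, he, ε, hε, hmaps, hanti⟩

/-- A symmetric interval around a point of `(s - ε, s + ε)` inside it. [folklore] -/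
theorem exists_Ioo_subset_Ioo {s ε s' : ℝ} (hs' : s' ∈ Ioo (s - ε) (s + ε)) :
    ∃ ε' > (0 : ℝ), Ioo (s' - ε') (s' + ε') ⊆ Ioo (s - ε) (s + ε) := by
  refine ⟨min (s' - (s - ε)) (s + ε - s'), lt_min (by linarith [hs'.1]) (by linarith [hs'.2]),
    fun r hr ↦ ⟨?_, ?_⟩⟩
  · linarith [hr.1, min_le_left (s' - (s - ε)) (s + ε - s')]
  · linarith [hr.2, min_le_right (s' - (s - ε)) (s + ε - s')]

/-- Positive transversality is an open condition on the parameter. [folklore] -/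
theorem isOpen_setOf_isPosTransverseAt (γ : ℝ → M) : IsOpen {s | F.IsPosTransverseAt γ s} := by
  rw [isOpen_iff_mem_nhds]
  rintro s ⟨e, he, ε, hε, hmaps, hmono⟩
  rw [mem_nhds_iff]
  refine ⟨Ioo (s - ε) (s + ε), fun s' hs' ↦ ?_, isOpen_Ioo, by constructor <;> linarith⟩
  obtain ⟨ε', hε', hsub⟩ := exists_Ioo_subset_Ioo hs'
  exact ⟨e, he, ε', hε', hmaps.mono_left hsub, hmono.mono hsub⟩

/-- Negative transversality is an open condition on the parameter. [folklore] -/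
theorem isOpen_setOf_isNegTransverseAt (γ : ℝ → M) : IsOpen {s | F.IsNegTransverseAt γ s} := by
  rw [isOpen_iff_mem_nhds]
  rintro s ⟨e, he, ε, hε, hmaps, hanti⟩
  rw [mem_nhds_iff]
  refine ⟨Ioo (s - ε) (s + ε), fun s' hs' ↦ ?_, isOpen_Ioo, by constructor <;> linarith⟩
  obtain ⟨ε', hε', hsub⟩ := exists_Ioo_subset_Ioo hs'
  exact ⟨e, he, ε', hε', hmaps.mono_left hsub, hanti.mono hsub⟩

/-! ## Transverse orientation: the direction does not depend on the flow box -/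

/-- **Order transfer between flow boxes along a curve.** For a transversely oriented atlas, a
continuous curve running in the flow box `e` near `s`, and another flow box `e'` of the atlas
containing `γ s`: on a smaller interval around `s` the curve runs in both boxes and the order of
`e`-heights along it implies the same order of `e'`-heights. [folklore] -/
theorem IsTransverselyOriented.exists_height_lt_imp (ho : F.IsTransverselyOriented)
    (hc : Continuous γ) {e e' : OpenPartialHomeomorph M (B × ℝ)} (he : e ∈ F.atlas)
    (he' : e' ∈ F.atlas) {ε : ℝ} (hε : 0 < ε) (hmaps : MapsTo γ (Ioo (s - ε) (s + ε)) e.source)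
    (hs : γ s ∈ e'.source) :
    ∃ ε' > (0 : ℝ), Ioo (s - ε') (s + ε') ⊆ Ioo (s - ε) (s + ε) ∧
      MapsTo γ (Ioo (s - ε') (s + ε')) e'.source ∧
      ∀ r₁ ∈ Ioo (s - ε') (s + ε'), ∀ r₂ ∈ Ioo (s - ε') (s + ε'),
        (e (γ r₁)).2 < (e (γ r₂)).2 → (e' (γ r₁)).2 < (e' (γ r₂)).2 := by
  have hse : γ s ∈ e.source := hmaps ⟨by linarith, by linarith⟩
  obtain ⟨U, hU, hUo⟩ := ho e he e' he' (γ s) ⟨hse, hs⟩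
  -- parameters near `s` are mapped into `U ∩ e'.source`
  have hnhds : γ ⁻¹' (U ∩ e'.source) ∈ 𝓝 s :=
    hc.continuousAt.preimage_mem_nhds (inter_mem hU (e'.open_source.mem_nhds hs))
  obtain ⟨ε₁, hε₁, hball⟩ := Metric.mem_nhds_iff.1 hnhds
  refine ⟨min ε ε₁, lt_min hε hε₁, fun r hr ↦ ⟨?_, ?_⟩, fun r hr ↦ ?_, fun r₁ hr₁ r₂ hr₂ hlt ↦ ?_⟩
  · linarith [hr.1, min_le_left ε ε₁]
  · linarith [hr.2, min_le_left ε ε₁]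
  · exact (hball (show r ∈ Metric.ball s ε₁ by
      rw [Metric.mem_ball, Real.dist_eq, abs_sub_lt_iff]
      constructor <;> linarith [hr.1, hr.2, min_le_right ε ε₁])).2
  · have hI : ∀ r ∈ Ioo (s - min ε ε₁) (s + min ε ε₁),
        γ r ∈ U ∩ (e.source ∩ e'.source) := fun r hr ↦ by
      have h₁ : r ∈ Ioo (s - ε) (s + ε) :=
        ⟨by linarith [hr.1, min_le_left ε ε₁], by linarith [hr.2, min_le_left ε ε₁]⟩
      have h₂ : γ r ∈ U ∩ e'.source := hball (by
        rw [Metric.mem_ball, Real.dist_eq, abs_sub_lt_iff]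
        constructor <;> linarith [hr.1, hr.2, min_le_right ε ε₁])
      exact ⟨h₂.1, hmaps h₁, h₂.2⟩
    exact hUo (γ r₁) (hI r₁ hr₁) (γ r₂) (hI r₂ hr₂) hlt

/-- **The direction does not depend on the flow box (positive case).** For a transversely
oriented atlas and a continuous curve `γ` positively transverse at `s`, the height of `γ` is
strictly increasing near `s` in every flow box of the atlas containing `γ s` (Hector–Hirsch A,
Ch. II 2.2.8: the changes of coordinates preserve the transverse orientation). [folklore] -/
theorem IsPosTransverseAt.exists_strictMonoOn (ho : F.IsTransverselyOriented) (hc : Continuous γ)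
    (h : F.IsPosTransverseAt γ s) {e' : OpenPartialHomeomorph M (B × ℝ)} (he' : e' ∈ F.atlas)
    (hs : γ s ∈ e'.source) :
    ∃ ε' > (0 : ℝ), MapsTo γ (Ioo (s - ε') (s + ε')) e'.source ∧
      StrictMonoOn (fun r ↦ (e' (γ r)).2) (Ioo (s - ε') (s + ε')) := by
  obtain ⟨e, he, ε, hε, hmaps, hmono⟩ := h
  obtain ⟨ε', hε', hsub, hmaps', himp⟩ := ho.exists_height_lt_imp hc he he' hε hmaps hs
  exact ⟨ε', hε', hmaps', fun r₁ hr₁ r₂ hr₂ hlt ↦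
    himp r₁ hr₁ r₂ hr₂ (hmono (hsub hr₁) (hsub hr₂) hlt)⟩

/-- **The direction does not depend on the flow box (negative case).** [folklore] -/
theorem IsNegTransverseAt.exists_strictAntiOn (ho : F.IsTransverselyOriented) (hc : Continuous γ)
    (h : F.IsNegTransverseAt γ s) {e' : OpenPartialHomeomorph M (B × ℝ)} (he' : e' ∈ F.atlas)
    (hs : γ s ∈ e'.source) :
    ∃ ε' > (0 : ℝ), MapsTo γ (Ioo (s - ε') (s + ε')) e'.source ∧
      StrictAntiOn (fun r ↦ (e' (γ r)).2) (Ioo (s - ε') (s + ε')) := by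
  obtain ⟨e, he, ε, hε, hmaps, hanti⟩ := h
  obtain ⟨ε', hε', hsub, hmaps', himp⟩ := ho.exists_height_lt_imp hc he he' hε hmaps hs
  exact ⟨ε', hε', hmaps', fun r₁ hr₁ r₂ hr₂ hlt ↦
    himp r₂ hr₂ r₁ hr₁ (hanti (hsub hr₁) (hsub hr₂) hlt)⟩

/-- **A curve is not both positively and negatively transverse at a parameter** (transversely
oriented atlas): read in one flow box containing `γ s`, its height would be both strictly
increasing and strictly decreasing on an interval. [folklore] -/
theorem not_isPosTransverseAt_and_isNegTransverseAt (ho : F.IsTransverselyOriented)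
    (hc : Continuous γ) : ¬ (F.IsPosTransverseAt γ s ∧ F.IsNegTransverseAt γ s) := by
  rintro ⟨hpos, e, he, ε, hε, hmaps, hanti⟩
  have hs : γ s ∈ e.source := hmaps ⟨by linarith, by linarith⟩
  obtain ⟨ε', hε', -, hmono⟩ := hpos.exists_strictMonoOn ho hc he hs
  -- two parameters in the common interval
  set ρ := min ε ε' with hρ
  have hρ0 : 0 < ρ := lt_min hε hε'
  have h₁ : s - ρ / 2 ∈ Ioo (s - ε) (s + ε) ∧ s - ρ / 2 ∈ Ioo (s - ε') (s + ε') :=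
    ⟨⟨by linarith [min_le_left ε ε'], by linarith⟩, ⟨by linarith [min_le_right ε ε'], by linarith⟩⟩
  have h₂ : s + ρ / 2 ∈ Ioo (s - ε) (s + ε) ∧ s + ρ / 2 ∈ Ioo (s - ε') (s + ε') :=
    ⟨⟨by linarith, by linarith [min_le_left ε ε']⟩, ⟨by linarith, by linarith [min_le_right ε ε']⟩⟩
  have hlt : s - ρ / 2 < s + ρ / 2 := by linarith
  exact lt_asymm (hmono h₁.2 h₂.2 hlt) (hanti h₁.1 h₂.1 hlt)

/-! ## Constant direction of closed transversals -/

/-- **A closed transversal of a transversely oriented foliation has constant direction**: it is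
positively transverse at every parameter, or negatively transverse at every parameter. The two
conditions are open in the parameter, exhaustive and mutually exclusive, and `ℝ` is connected.
(Hector–Hirsch A, Ch. II 2.2.8, 2.2.9: for transversely oriented foliations transverse curves
are oriented.) [folklore] -/
theorem IsClosedTransversal.forall_isPosTransverseAt_or (ho : F.IsTransverselyOriented)
    (hγ : F.IsClosedTransversal γ) :
    (∀ s, F.IsPosTransverseAt γ s) ∨ (∀ s, F.IsNegTransverseAt γ s) := by
  have hcompl : {s | F.IsPosTransverseAt γ s}ᶜ = {s | F.IsNegTransverseAt γ s} := by
    ext s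
    simp only [mem_compl_iff, mem_setOf_eq]
    constructor
    · intro h
      exact (hγ.isPosTransverseAt_or s).resolve_left h
    · intro h h'
      exact not_isPosTransverseAt_and_isNegTransverseAt ho hγ.1 ⟨h', h⟩
  have hclopen : IsClopen {s | F.IsPosTransverseAt γ s} := by
    refine ⟨⟨?_⟩, isOpen_setOf_isPosTransverseAt γ⟩
    rw [hcompl]
    exact isOpen_setOf_isNegTransverseAt γ
  rcases isClopen_iff.1 hclopen with h | h
  · right
    intro s
    have hs : s ∈ {s | F.IsPosTransverseAt γ s}ᶜ := by
      rw [h]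
      exact fun h ↦ h
    rwa [hcompl] at hs
  · left
    intro s
    have hs : s ∈ {s | F.IsPosTransverseAt γ s} := by
      rw [h]
      exact mem_univ s
    exact hs

/-! ## Reversal; positive transversals through every leaf of a taut foliation -/

/-- **Reversing a closed transversal**: `s ↦ γ (-s)` is again a closed transversal. [folklore] -/
theorem IsClosedTransversal.reverse (hγ : F.IsClosedTransversal γ) :
    F.IsClosedTransversal (fun s ↦ γ (-s)) := by
  refine ⟨hγ.1.comp continuous_neg, fun s ↦ ?_, fun s ↦ ?_⟩
  · simp only
    rw [neg_add, ← hγ.2.1 (-s + -1)]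
    ring_nf
  · obtain ⟨e, he, ε, hε, hmaps, hmono⟩ := hγ.2.2 (-s)
    have hneg : ∀ r ∈ Ioo (s - ε) (s + ε), -r ∈ Ioo (-s - ε) (-s + ε) := fun r hr ↦
      ⟨by linarith [hr.2], by linarith [hr.1]⟩
    refine ⟨e, he, ε, hε, fun r hr ↦ hmaps (hneg r hr), ?_⟩
    rcases hmono with hmono | hanti
    · exact Or.inr fun r₁ hr₁ r₂ hr₂ hlt ↦ hmono (hneg r₂ hr₂) (hneg r₁ hr₁) (by linarith)
    · exact Or.inl fun r₁ hr₁ r₂ hr₂ hlt ↦ hanti (hneg r₂ hr₂) (hneg r₁ hr₁) (by linarith)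

/-- Reversal turns negative transversality at `-s` into positive transversality at `s`.
[folklore] -/
theorem IsNegTransverseAt.reverse (h : F.IsNegTransverseAt γ (-s)) :
    F.IsPosTransverseAt (fun r ↦ γ (-r)) s := by
  obtain ⟨e, he, ε, hε, hmaps, hanti⟩ := h
  have hneg : ∀ r ∈ Ioo (s - ε) (s + ε), -r ∈ Ioo (-s - ε) (-s + ε) := fun r hr ↦
    ⟨by linarith [hr.2], by linarith [hr.1]⟩
  exact ⟨e, he, ε, hε, fun r hr ↦ hmaps (hneg r hr),
    fun r₁ hr₁ r₂ hr₂ hlt ↦ hanti (hneg r₂ hr₂) (hneg r₁ hr₁) (by linarith)⟩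

/-- **A taut transversely oriented foliation has a positive closed transversal through every
leaf**: the closed transversal through `F.leaf x` given by tautness has constant direction
(`forall_isPosTransverseAt_or`); if negative, reverse it. [folklore] -/
theorem IsTaut.exists_pos (ho : F.IsTransverselyOriented) (ht : F.IsTaut) (x : M) :
    ∃ γ : ℝ → M, F.IsClosedTransversal γ ∧ (∀ s, F.IsPosTransverseAt γ s) ∧
      ∃ s, γ s ∈ F.leaf x := by
  obtain ⟨γ, hγ, s, hs⟩ := ht x
  rcases hγ.forall_isPosTransverseAt_or ho with hpos | hneg
  · exact ⟨γ, hγ, hpos, s, hs⟩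
  · refine ⟨fun r ↦ γ (-r), hγ.reverse, fun r ↦ (hneg (-r)).reverse, -s, ?_⟩
    simp only [neg_neg]
    exact hs

end Foliation

end Literature.Topology.FourManifolds
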